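import Summits.Ventures.CertifiedQuantumChemistry.Rows.HubbardRingTVDihedralSymmetry
import Summits.Ventures.CertifiedQuantumChemistry.Rows.LiebSingletBridge
import Literature.MathematicalPhysics.QuantumLattice.HubbardGroundStateLatticeCovariance
import Literature.MathematicalPhysics.QuantumLattice.HubbardModelParticleHoleProofs
import HarnessLib

/-!
# Ventures/CertifiedQuantumChemistry — Rows/HubbardRingTVGroundStateSymmetry.lean: the EXACT side of the
# dihedral symmetry — in the (unique) half-filled ground state of the even TV-H ring every one-body
# expectation is rotation-, reflection- and spin-exchange-invariant: `⟨n_{pσ}⟩ = ½`, uniform double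
# occupancy, one nearest-neighbour bond amplitude

HONEST FRAMING (verbatim): certified bounds for a stated model Hamiltonian in a stated basis; not a
claim about the real molecule beyond that model.

Seat rdm-B, ROWS courtesy file (theorems only; no `def`, no notation, no instance; zero compute). The
relaxation side (`Rows/HubbardRingTVDihedralSymmetry*.lean`: a dihedral-invariant OPTIMAL pair exists,
with occupations `1/2`) has an exact counterpart that needs no averaging: by Lieb's theorem the
`2n`-electron ground state of `hubbardRingTV (2n) t U` (`t ≠ 0`, `U > 0`) is unique, so it carries a
one-dimensional representation of every symmetry of the Hamiltonian and all its expectation values are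
invariant (the tree's `Literature/…/HubbardGroundStateLatticeCovariance.lean`, stated for any connected
balanced bipartite graph and specialised there to the square torus). This file is the RING instance, on
the cell's own model object (`(hubbardRingTV L t U).hamiltonian = hamiltonian (ringGraph L) t U`,
`Rows/LiebSingletBridge.lean`), for every `ψ` with `IsGroundState (hubbardRingTV (2n) t U).hamiltonian (2n) ψ`:

* §1 `hubbardRingTV_groundState_oneBody_dihedral`, `…_densityDensity_dihedral`: for every `x` in the
  dihedral subgroup generated by `finRotate (2n)` and `Fin.revPerm`,
  `⟨c†_{x p,σ} c_{x q,τ}⟩_ψ = ⟨c†_{pσ} c_{qτ}⟩_ψ` and `⟨n_{x p,σ} n_{x q,τ}⟩_ψ = ⟨n_{pσ} n_{qτ}⟩_ψ`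
  (graph automorphisms of the ring: `RingSymmetry.ringAdj_perm_iff_of_mem_dihedral`).
* §2 **`hubbardRingTV_groundState_density_eq`** (`⟨n_{pσ}⟩_ψ = ⟨n_{qτ}⟩_ψ` for all sites AND both spins —
  rotations act transitively, the spin exchange is a symmetry), **`hubbardRingTV_groundState_density_eq_half`**
  (`⟨n_{pσ}⟩_ψ = ⟨ψ, ψ⟩/2`: the `4n` equal occupations sum to `2n·⟨ψ, ψ⟩`), `…_doubleOccupancy_eq`
  (`⟨n_{p↑} n_{p↓}⟩_ψ` is site-independent).
* §3 `hubbardRingTV_groundState_bond_eq` (`⟨c†_{pσ} c_{(p+1)σ}⟩_ψ` is the same for every site and spin)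
  and `hubbardRingTV_groundState_bond_reverse` (`= ⟨c†_{(p+1)σ} c_{pσ}⟩_ψ`: the reflection reverses the
  orientation) — ONE nearest-neighbour bond amplitude, as benchmark tables assume.

READING: statements about the exact ground state of the cell's own model object (which EXISTS and is
unique up to phase by Lieb's theorem — `LiebHalfFilled.exists_unit_groundState`; not restated); no
certificate, row, claim node or value of record depends on them. All PROVED (0 sorry, standard axioms);
no definitions, no named facts. References (docstring-only): E. H. Lieb, Phys. Rev. Lett. 62 (1989)
1201, Thm 2; E. H. Lieb, M. Loss, R. J. McCann, J. Math. Phys. 34 (1993) 891, p. 894 (symmetry of the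
unique ground state). Tree (REUSED): `expect_creation_mul_annihilation_mapEquiv_of_groundState`,
`expect_numberOp_mul_numberOp_mapEquiv_of_groundState`, `expect_creation_mul_annihilation_down_eq_up_of_groundState`,
`totalNumber_mulVec_of_isNParticle` (Literature); `hubbardRingTV_hamiltonian_eq`, `ringGraph_adj`,
`ringGraph_connected`, `evenSites_bipartite`, `card_compl_evenSites` (`Rows/LiebSingletBridge`);
`RingSymmetry.ringAdj_perm_iff_of_mem_dihedral`, `exists_finRotate_pow_apply_eq` (`Rows/HubbardRingTVDihedralSymmetry`).
-/

noncomputable section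

namespace Summit.Ventures.CertifiedQuantumChemistry

open Matrix Finset
open Literature.MathematicalPhysics.QuantumLattice Literature.MathematicalPhysics.QuantumChemistry
open Summit.Ventures.CertifiedQuantumChemistry.Hamiltonians
open scoped ComplexOrder

section GroundState

variable {n : ℕ} {t U : ℚ} {ψ : Fock (Orb (Fin (2 * n)))}

/-- A ground state of the cell's model Hamiltonian is a ground state of the tree's graph Hubbard
Hamiltonian of the `2n`-ring at half filling `N = |Λ|` (the bridge `hubbardRingTV_hamiltonian_eq`). -/
theorem hubbardRingTV_isGroundState_graph
    (hψ : IsGroundState (hubbardRingTV (2 * n) t U).hamiltonian (2 * n) ψ) :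
    IsGroundState (hamiltonian (ringGraph (2 * n)) (t : ℝ) (U : ℝ)) (Fintype.card (Fin (2 * n))) ψ := by
  rw [Fintype.card_fin, ← hubbardRingTV_hamiltonian_eq]
  exact hψ

/-! ## §1 Dihedral invariance of the one-body and density–density expectations -/

/-- **`⟨c†_{x p,σ} c_{x q,τ}⟩_ψ = ⟨c†_{pσ} c_{qτ}⟩_ψ` for every `x` of the dihedral subgroup** of the
`2n`-ring (`n ≥ 1`, `t ≠ 0`, `U > 0`, `ψ` a half-filled ground state of `hubbardRingTV (2n) t U`).
[folklore] -/
theorem hubbardRingTV_groundState_oneBody_dihedral (hn : 1 ≤ n) (ht : t ≠ 0) (hU : 0 < U)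
    (hψ : IsGroundState (hubbardRingTV (2 * n) t U).hamiltonian (2 * n) ψ)
    {x : Equiv.Perm (Fin (2 * n))}
    (hx : x ∈ Subgroup.closure ({finRotate (2 * n), Fin.revPerm} : Set (Equiv.Perm (Fin (2 * n)))))
    (p q : Fin (2 * n)) (σ τ : Fin 2) :
    expect (creation (orb (x p) σ) * annihilation (orb (x q) τ)) ψ =
      expect (creation (orb p σ) * annihilation (orb q τ)) ψ :=
  expect_creation_mul_annihilation_mapEquiv_of_groundState (ringGraph_connected (by omega : 0 < 2 * n))
    (evenSites (2 * n)) (evenSites_bipartite n) (card_compl_evenSites n)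
    (by exact_mod_cast ht) (by exact_mod_cast hU) x
    (fun a b => by rw [ringGraph_adj, ringGraph_adj]; exact RingSymmetry.ringAdj_perm_iff_of_mem_dihedral hx a b)
    (hubbardRingTV_isGroundState_graph hψ) p q σ τ

/-- **`⟨n_{x p,σ} n_{x q,τ}⟩_ψ = ⟨n_{pσ} n_{qτ}⟩_ψ`** for every `x` of the dihedral subgroup. [folklore] -/
theorem hubbardRingTV_groundState_densityDensity_dihedral (hn : 1 ≤ n) (ht : t ≠ 0) (hU : 0 < U)
    (hψ : IsGroundState (hubbardRingTV (2 * n) t U).hamiltonian (2 * n) ψ)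
    {x : Equiv.Perm (Fin (2 * n))}
    (hx : x ∈ Subgroup.closure ({finRotate (2 * n), Fin.revPerm} : Set (Equiv.Perm (Fin (2 * n)))))
    (p q : Fin (2 * n)) (σ τ : Fin 2) :
    expect (numberOp (x p) σ * numberOp (x q) τ) ψ = expect (numberOp p σ * numberOp q τ) ψ :=
  expect_numberOp_mul_numberOp_mapEquiv_of_groundState (ringGraph_connected (by omega : 0 < 2 * n))
    (evenSites (2 * n)) (evenSites_bipartite n) (card_compl_evenSites n)
    (by exact_mod_cast ht) (by exact_mod_cast hU) x
    (fun a b => by rw [ringGraph_adj, ringGraph_adj]; exact RingSymmetry.ringAdj_perm_iff_of_mem_dihedral hx a b)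
    (hubbardRingTV_isGroundState_graph hψ) p q σ τ

/-- Powers of the rotation lie in the dihedral subgroup. -/
theorem finRotate_pow_mem_dihedral (L k : ℕ) :
    finRotate L ^ k ∈ Subgroup.closure ({finRotate L, Fin.revPerm} : Set (Equiv.Perm (Fin L))) :=
  Subgroup.pow_mem _ (Subgroup.subset_closure (Set.mem_insert _ _)) k

/-- The reflection lies in the dihedral subgroup. -/
theorem revPerm_mem_dihedral (L : ℕ) :
    (Fin.revPerm : Equiv.Perm (Fin L)) ∈ Subgroup.closure ({finRotate L, Fin.revPerm} : Set (Equiv.Perm (Fin L))) :=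
  Subgroup.subset_closure (Set.mem_insert_of_mem _ rfl)

/-! ## §2 Uniform density `⟨n_{pσ}⟩ = ½` and uniform double occupancy -/

/-- **THE DENSITY IS UNIFORM IN SITE AND SPIN**: `⟨n_{pσ}⟩_ψ = ⟨n_{qτ}⟩_ψ` for all `p, q, σ, τ`
(rotations act transitively on the sites; the spin exchange is a symmetry of the unique ground state —
the tree's `expect_creation_mul_annihilation_down_eq_up_of_groundState`). [folklore] -/
theorem hubbardRingTV_groundState_density_eq (hn : 1 ≤ n) (ht : t ≠ 0) (hU : 0 < U)
    (hψ : IsGroundState (hubbardRingTV (2 * n) t U).hamiltonian (2 * n) ψ)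
    (p q : Fin (2 * n)) (σ τ : Fin 2) :
    expect (numberOp p σ) ψ = expect (numberOp q τ) ψ := by
  -- same spin at every site, via a rotation power carrying `q` to `p`
  have hsite : ∀ (υ : Fin 2) (a b : Fin (2 * n)), expect (numberOp a υ) ψ = expect (numberOp b υ) ψ := by
    intro υ a b
    obtain ⟨k, hk⟩ := RingSymmetry.exists_finRotate_pow_apply_eq a b
    have h := hubbardRingTV_groundState_oneBody_dihedral hn ht hU hψ (finRotate_pow_mem_dihedral (2 * n) k)
      b b υ υ
    rw [hk] at h
    exact h
  -- both spins at one site: `⟨n_{p↓}⟩ = ⟨n_{p↑}⟩`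
  have hspin : ∀ a : Fin (2 * n), expect (numberOp a 1) ψ = expect (numberOp a 0) ψ := fun a =>
    expect_creation_mul_annihilation_down_eq_up_of_groundState (ringGraph_connected (by omega : 0 < 2 * n))
      (evenSites (2 * n)) (evenSites_bipartite n) (card_compl_evenSites n)
      (by exact_mod_cast ht) (by exact_mod_cast hU) (hubbardRingTV_isGroundState_graph hψ) a a
  have hspin' : ∀ (υ : Fin 2) (a : Fin (2 * n)), expect (numberOp a υ) ψ = expect (numberOp a 0) ψ := by
    intro υ a
    fin_cases υ
    · rfl
    · exact hspin a
  rw [hspin' σ p, hspin' τ q, hsite 0 p q]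

/-- **`⟨n_{pσ}⟩_ψ = ⟨ψ, ψ⟩ / 2` AT EVERY SITE AND SPIN** (half filling: the `4n` equal occupations sum
to `⟨ψ, N̂ ψ⟩ = 2n·⟨ψ, ψ⟩`). For a unit ground state this is the textbook `⟨n_{pσ}⟩ = ½`. [folklore] -/
theorem hubbardRingTV_groundState_density_eq_half (hn : 1 ≤ n) (ht : t ≠ 0) (hU : 0 < U)
    (hψ : IsGroundState (hubbardRingTV (2 * n) t U).hamiltonian (2 * n) ψ)
    (p : Fin (2 * n)) (σ : Fin 2) :
    expect (numberOp p σ) ψ = (star ψ ⬝ᵥ ψ) / 2 := by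
  have hN : (totalNumber : Matrix (Finset (Orb (Fin (2 * n)))) (Finset (Orb (Fin (2 * n)))) ℂ) *ᵥ ψ =
      ((2 * n : ℕ) : ℂ) • ψ := totalNumber_mulVec_of_isNParticle hψ.1
  have hsum : ∑ x : Fin (2 * n), ∑ υ : Fin 2, expect (numberOp x υ) ψ = ((2 * n : ℕ) : ℂ) * (star ψ ⬝ᵥ ψ) := by
    have h : ∑ x : Fin (2 * n), ∑ υ : Fin 2, expect (numberOp x υ) ψ = expect totalNumber ψ := by
      simp only [Literature.MathematicalPhysics.QuantumLattice.expect, totalNumber, Matrix.sum_mulVec,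
        dotProduct_sum]
    rw [h, Literature.MathematicalPhysics.QuantumLattice.expect, hN, dotProduct_smul, smul_eq_mul]
  have hconst : ∑ x : Fin (2 * n), ∑ υ : Fin 2, expect (numberOp x υ) ψ =
      ((2 * n : ℕ) : ℂ) * (2 * expect (numberOp p σ) ψ) := by
    rw [Finset.sum_congr rfl fun x _ => Finset.sum_congr rfl fun υ _ =>
      hubbardRingTV_groundState_density_eq hn ht hU hψ x p υ σ]
    simp only [Finset.sum_const, Finset.card_univ, Fintype.card_fin, nsmul_eq_mul]
    push_cast
    ring
  have h2n : ((2 * n : ℕ) : ℂ) ≠ 0 := Nat.cast_ne_zero.2 (by omega)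
  have h := hsum.symm.trans hconst
  have h' : star ψ ⬝ᵥ ψ = 2 * expect (numberOp p σ) ψ := mul_left_cancel₀ h2n h
  rw [h']
  ring

/-- **THE DOUBLE OCCUPANCY IS UNIFORM**: `⟨n_{p↑} n_{p↓}⟩_ψ = ⟨n_{q↑} n_{q↓}⟩_ψ` for all sites. [folklore] -/
theorem hubbardRingTV_groundState_doubleOccupancy_eq (hn : 1 ≤ n) (ht : t ≠ 0) (hU : 0 < U)
    (hψ : IsGroundState (hubbardRingTV (2 * n) t U).hamiltonian (2 * n) ψ) (p q : Fin (2 * n)) :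
    expect (numberOp p 0 * numberOp p 1) ψ = expect (numberOp q 0 * numberOp q 1) ψ := by
  obtain ⟨k, hk⟩ := RingSymmetry.exists_finRotate_pow_apply_eq p q
  have h := hubbardRingTV_groundState_densityDensity_dihedral hn ht hU hψ (finRotate_pow_mem_dihedral (2 * n) k)
    q q 0 1
  rw [hk] at h
  exact h

/-! ## §3 One nearest-neighbour bond amplitude -/

/-- **THE NEAREST-NEIGHBOUR BOND AMPLITUDE IS SITE- AND SPIN-INDEPENDENT**:
`⟨c†_{pσ} c_{(p+1)σ}⟩_ψ = ⟨c†_{qτ} c_{(q+1)τ}⟩_ψ` (`p + 1 = finRotate p`). [folklore] -/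
theorem hubbardRingTV_groundState_bond_eq (hn : 1 ≤ n) (ht : t ≠ 0) (hU : 0 < U)
    (hψ : IsGroundState (hubbardRingTV (2 * n) t U).hamiltonian (2 * n) ψ)
    (p q : Fin (2 * n)) (σ τ : Fin 2) :
    expect (creation (orb p σ) * annihilation (orb (finRotate (2 * n) p) σ)) ψ =
      expect (creation (orb q τ) * annihilation (orb (finRotate (2 * n) q) τ)) ψ := by
  -- sites: rotate `q ↦ p` (powers of the rotation commute with the rotation)
  have hsite : ∀ (υ : Fin 2) (a b : Fin (2 * n)),
      expect (creation (orb a υ) * annihilation (orb (finRotate (2 * n) a) υ)) ψ =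
        expect (creation (orb b υ) * annihilation (orb (finRotate (2 * n) b) υ)) ψ := by
    intro υ a b
    obtain ⟨k, hk⟩ := RingSymmetry.exists_finRotate_pow_apply_eq a b
    have hcomm : (finRotate (2 * n) ^ k) (finRotate (2 * n) b) = finRotate (2 * n) ((finRotate (2 * n) ^ k) b) := by
      rw [← Equiv.Perm.mul_apply, ← Equiv.Perm.mul_apply, ← pow_succ, ← pow_succ']
    have h := hubbardRingTV_groundState_oneBody_dihedral hn ht hU hψ (finRotate_pow_mem_dihedral (2 * n) k)
      b (finRotate (2 * n) b) υ υ
    rw [hcomm, hk] at h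
    exact h
  -- spins: `↓ = ↑`
  have hspin : ∀ (υ : Fin 2) (a : Fin (2 * n)),
      expect (creation (orb a υ) * annihilation (orb (finRotate (2 * n) a) υ)) ψ =
        expect (creation (orb a 0) * annihilation (orb (finRotate (2 * n) a) 0)) ψ := by
    intro υ a
    fin_cases υ
    · rfl
    · exact expect_creation_mul_annihilation_down_eq_up_of_groundState
        (ringGraph_connected (by omega : 0 < 2 * n)) (evenSites (2 * n)) (evenSites_bipartite n)
        (card_compl_evenSites n) (by exact_mod_cast ht) (by exact_mod_cast hU)
        (hubbardRingTV_isGroundState_graph hψ) a (finRotate (2 * n) a)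
  rw [hspin σ p, hspin τ q, hsite 0 p q]

/-- **The bond amplitude does not depend on the orientation**:
`⟨c†_{(p+1)σ} c_{pσ}⟩_ψ = ⟨c†_{pσ} c_{(p+1)σ}⟩_ψ` (the reflection `rev` reverses the bonds: `rev (p + 1) + 1 = rev p`).
[folklore] -/
theorem hubbardRingTV_groundState_bond_reverse (hn : 1 ≤ n) (ht : t ≠ 0) (hU : 0 < U)
    (hψ : IsGroundState (hubbardRingTV (2 * n) t U).hamiltonian (2 * n) ψ) (p : Fin (2 * n)) (σ : Fin 2) :
    expect (creation (orb (finRotate (2 * n) p) σ) * annihilation (orb p σ)) ψ =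
      expect (creation (orb p σ) * annihilation (orb (finRotate (2 * n) p) σ)) ψ := by
  haveI : NeZero (2 * n) := ⟨by omega⟩
  -- reflect: with `q := rev (p + 1)` the reflection maps the bond `(q, q + 1)` onto `(p + 1, p)`
  set q := Fin.rev (finRotate (2 * n) p) with hq
  have h1 : Fin.revPerm q = finRotate (2 * n) p := by rw [Fin.revPerm_apply, hq, Fin.rev_rev]
  have h2 : Fin.revPerm (finRotate (2 * n) q) = p := by
    rw [Fin.revPerm_apply, finRotate_apply q, hq, finRotate_apply p, Fin.rev_add, Fin.rev_rev,
      add_sub_cancel_right]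
  have h := hubbardRingTV_groundState_oneBody_dihedral hn ht hU hψ (revPerm_mem_dihedral (2 * n)) q
    (finRotate (2 * n) q) σ σ
  rw [h1, h2] at h
  rw [h, hubbardRingTV_groundState_bond_eq hn ht hU hψ q p σ σ]

end GroundState

end Summit.Ventures.CertifiedQuantumChemistry

end
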